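import Mathlib
import HarnessLib
import Literature.Analysis.FluidPDE.FlatSwirlGauge
import Literature.Analysis.FluidPDE.NSLocalLerayBackwardUniqueness
import Summits.NavierStokesRegularity.NavierStokesRegularity.Theorems.PoloidalWindowDoorPoloidalWindowRigidityZeroMeanMomentum
import Summits.NavierStokesRegularity.NavierStokesRegularity.Theorems.PoloidalWindowDoorPoloidalWindowRigidityVorticityAxisymmetric
import Summits.NavierStokesRegularity.NavierStokesRegularity.Theorems.PoloidalWindowDoorPoloidalWindowRigidityAnyAxis
import Summits.NavierStokesRegularity.NavierStokesRegularity.Theorems.PoloidalWindowDoorPoloidalWindowRigiditySymmetryGerms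

/-!
# K2 `PoloidalWindowRigidity` (stmt-NavierStokesRegularity-19708) — THE ONE-SLICE, ANY-AXIS FORM OF STRATUM (A′):
# the vorticity of ONE slice axisymmetric about SOME vertical axis ⇒ `v ≡ 0`; and its germ form

Cell ns-regularity-ideate, seat nsreg-p7 gen 7 (third worker under the K2 lead ns-poloidal-K2-p1).  The lead's proposed
line «lrc-jet» (LINE-PROPOSAL-lrc-jet.md; conjecture LRC′) outputs, in its rotational branch, a one-parameter group of
rotations of the VORTICITY about a vertical axis `c(t) + ℝe₃` WHOSE POSITION MAY MOVE IN TIME (K2P1-LOCAL-NOTES v4 §11: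
«minimiser = rotation about a nearby vertical axis moving in time»).  The tree's stratum (A′)
`…VorticityAxisymmetric.eq_zero_of_curl_axisymmetric_translate` needs the vorticity axisymmetric about ONE FIXED axis on
EVERY slice, and ns-poloidal-K2-p3's germ form `…LocalVorticitySymmetry.nonflatLiouville_of_local_curl_rotation` needs
the Killing identity on an open SPACE–TIME set with a fixed centre.  This file removes the gap: ONE slice, ANY axis.
The new (M)-input is ZERO LARGE-SCALE MOMENTUM (`…ZeroMeanMomentum.eq_zero_of_slice_sub_eq_const`: two profiles of the
class whose slices at one time differ by a constant vector are equal there — large-scale momentum conservation + the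
Type-I decay in the far past).

* `eq_zero_of_curl_axisymmetric_slice₀` / `eq_zero_of_curl_axisymmetric_slice` — **(A′₁)**: a profile of the route's
  Type-I class, poloidal along `e₃` on every slice, ONE of whose vorticity slices `curl v(s)` is axisymmetric about the
  vertical axis through some `c`, vanishes identically.  Proof: translate `c` to `0`; by the tree's kinematics
  `sub_apply_zero_isAxisymmetric_of_curl`, `u = v(s) − v(s)(0)` is axisymmetric; the profile conjugated by the rotation
  `R_π` is again in the class (`class_conj_linearIsometryEquiv`) and its `s`-slice differs from `v(s)` by the constant
  `R_{−π}b − b = −2b_h`, `b = v(s)(0)`; so `b_h = 0`, the slice `v(s)` itself is axisymmetric (a vertical constant is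
  allowed), and the tree's one-slice theorem `…OneSlice.eq_zero_of_axisymmetric_slice` (KNSS 2009 Thm 5.2) concludes.
* `eq_zero_of_curl_rotDefect_eq_zero_on_open` — germ form (stub L2 of «lrc-jet», rotational half, strongest form):
  if on a nonempty OPEN SET of ONE slice the rotational Killing identity `J ω(y) = Dω(y)(J(y − c))` holds for
  `ω = curl v(s)`, then `v ≡ 0` (analytic spreading over the slice by `…SymmetryGerms.rotDefect_eq_zero_of_eqOn_open`,
  integration by `…SymmetryGerms.isAxisymmetric_of_rotDefect_eq_zero`, then (A′₁)).  `nonflatLiouville_…` forms included.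

WHAT THIS IS NOT: not a claim about Navier–Stokes regularity, not LRC′, not the crux — a settled stratum in the form
the proposed line consumes (bears_on LADDER-NS N0, route PoloidalWindowDoor, crux K2; `--supports` the K2 item).
-/

noncomputable section

-- the summit and its single sub-problem share the name (CONVENTIONS §1), as in every Theorems file
set_option linter.dupNamespace false

namespace Summit.NavierStokesRegularity.NavierStokesRegularity.Theorems.PoloidalWindowDoorPoloidalWindowRigidityOneSliceCurlAxisymmetric

open MeasureTheory Set Function Filter Topology Metric InnerProductSpace
open scoped RealInnerProductSpace
open Literature.Analysis Literature.Analysis.FluidPDE Literature.Analysis.UnboundedOperators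
open Summit.NavierStokesRegularity.NavierStokesRegularity.Theorems.LocalSineTubeDoorProfileAlignedWindowRigidityAncient
open Summit.NavierStokesRegularity.NavierStokesRegularity.Theorems.PoloidalWindowDoorPoloidalWindowRigidityZeroMeanMomentum
open Summit.NavierStokesRegularity.NavierStokesRegularity.Theorems.PoloidalWindowDoorPoloidalWindowRigidityVorticityAxisymmetric
open Summit.NavierStokesRegularity.NavierStokesRegularity.Theorems.PoloidalWindowDoorPoloidalWindowRigidityAxisymmetric
open Summit.NavierStokesRegularity.NavierStokesRegularity.Theorems.PoloidalWindowDoorPoloidalWindowRigidityRotate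
open Summit.NavierStokesRegularity.NavierStokesRegularity.Theorems.PoloidalWindowDoorPoloidalWindowRigidityOneSlice
open Summit.NavierStokesRegularity.NavierStokesRegularity.Theorems.PoloidalWindowDoorPoloidalWindowRigiditySymmetryGerms
open Summit.NavierStokesRegularity.NavierStokesRegularity.Theorems.PoloidalWindowDoorPoloidalWindowRigidityFlat

variable {C : ℝ} {v : ℝ → EuclideanSpace ℝ (Fin 3) → EuclideanSpace ℝ (Fin 3)}

/-! ### (A′₁): the vorticity of ONE slice axisymmetric about SOME vertical axis -/

/-- A vector with vanishing horizontal components is fixed by the rotations about the vertical axis. -/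
theorem rotZ_eq_self_of_horizontal_eq_zero {b : EuclideanSpace ℝ (Fin 3)} (h0 : b 0 = 0) (h1 : b 1 = 0) (θ : ℝ) :
    rotZ θ b = b := by
  ext i
  fin_cases i <;> simp [h0, h1]

/-- **(A′₁), axis through the origin.**  A profile of the route's Type-I class, poloidal along `e₃` on every slice, ONE
of whose vorticity slices is axisymmetric about the vertical coordinate axis, vanishes identically. -/
theorem eq_zero_of_curl_axisymmetric_slice₀ (hrate : HasTypeITimeDecay C v)
    (hcont : ContinuousOn (uncurry v) (Iio (0 : ℝ) ×ˢ univ))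
    (hmild : ∀ s t : ℝ, s < t → t < 0 → ∀ x,
      v t x = heatExtension (v s) (t - s) x - oseenDuhamel 1 s v v t x)
    (hdiv : ∀ t < 0, VectorCalculus.IsDivFree (v t))
    (hpol : ∀ s < 0, ∀ y, ⟪curl (v s) y, EuclideanSpace.single 2 1⟫_ℝ = 0)
    {s : ℝ} (hs : s < 0) (haxi : IsAxisymmetric (curl (v s))) : ∀ t < 0, ∀ x, v t x = 0 := by
  have hbdd := bdd_of_hasTypeITimeDecay hrate
  have hA : AnalyticOnNhd ℝ (v s) univ := analyticOnNhd_slice hcont hbdd hmild hs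
  have hV2 : ContDiff ℝ 2 (v s) := hA.contDiff
  -- kinematics: `u = v(s) − b` is axisymmetric, `b = v(s)(0)`
  set b : EuclideanSpace ℝ (Fin 3) := v s 0 with hb
  have hu : IsAxisymmetric (fun y => v s y - v s 0) :=
    sub_apply_zero_isAxisymmetric_of_curl hV2 (hdiv s hs) (fun y => hrate s hs y) haxi
  -- the profile conjugated by the rotation `R_π` is in the class
  set L : EuclideanSpace ℝ (Fin 3) ≃ₗᵢ[ℝ] EuclideanSpace ℝ (Fin 3) := (rotZLIE Real.pi).symm with hL
  obtain ⟨hrate', hcont', hmild', -⟩ := class_conj_linearIsometryEquiv L hrate hcont hmild hdiv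
  -- its `s`-slice differs from `v(s)` by the constant `R_{−π} b − b`
  have hdiff : ∀ y, (fun t x => L (v t (L.symm x))) s y - v s y = rotZ (-Real.pi) b - b := by
    intro y
    have h1 : v s (rotZ Real.pi y) - v s 0 = rotZ Real.pi (v s y - v s 0) := hu Real.pi y
    have h2 : v s (rotZ Real.pi y) = rotZ Real.pi (v s y - b) + b := by rw [hb]; rw [← h1]; abel
    show L (v s (L.symm y)) - v s y = rotZ (-Real.pi) b - b
    simp only [hL, LinearIsometryEquiv.symm_symm, rotZLIE_symm_apply, rotZLIE_apply]
    rw [h2, show rotZ (-Real.pi) (rotZ Real.pi (v s y - b) + b) =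
      rotZ (-Real.pi) (rotZ Real.pi (v s y - b)) + rotZ (-Real.pi) b from map_add (rotZL (-Real.pi)) _ _,
      ← rotZ_add, neg_add_cancel, rotZ_zero]
    abel
  have hzero : rotZ (-Real.pi) b - b = 0 :=
    eq_zero_of_slice_sub_eq_const hrate hcont hmild hrate' hcont' hmild' hs hdiff
  -- hence `b` is vertical
  have hb0 : b 0 = 0 := by
    have h := congrArg (fun z : EuclideanSpace ℝ (Fin 3) => z 0) hzero
    simp only [PiLp.sub_apply, rotZ_apply_zero, Real.cos_neg, Real.cos_pi, Real.sin_neg, Real.sin_pi,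
      PiLp.zero_apply] at h
    linarith
  have hb1 : b 1 = 0 := by
    have h := congrArg (fun z : EuclideanSpace ℝ (Fin 3) => z 1) hzero
    simp only [PiLp.sub_apply, rotZ_apply_one, Real.cos_neg, Real.cos_pi, Real.sin_neg, Real.sin_pi,
      PiLp.zero_apply] at h
    linarith
  -- so the velocity slice itself is axisymmetric
  have haxv : IsAxisymmetric (fun y => v s (y + 0)) := by
    intro θ y
    simp only [add_zero]
    have h1 : v s (rotZ θ y) - v s 0 = rotZ θ (v s y - v s 0) := hu θ y
    have hbθ : rotZ θ b = b := rotZ_eq_self_of_horizontal_eq_zero hb0 hb1 θ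
    have h2 : rotZ θ (v s y - b) = rotZ θ (v s y) - rotZ θ b := map_sub (rotZL θ) _ _
    rw [hb] at hbθ h2
    rw [h2, hbθ] at h1
    have := sub_eq_sub_iff_add_eq_add.1 h1
    -- `v s (R y) + v s 0 = R (v s y) + v s 0`
    exact add_right_cancel this
  exact eq_zero_of_axisymmetric_slice hrate hcont hmild hdiv hpol 0 hs haxv

/-- **(A′₁): THE VORTICITY OF ONE SLICE AXISYMMETRIC ABOUT SOME VERTICAL AXIS ⇒ TRIVIAL.**  A profile of the route's Type-I
class, poloidal along `e₃` on every slice, ONE of whose vorticity slices is axisymmetric about the vertical axis through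
some point `c` (`curl v(s)(c + R_θ z) = R_θ curl v(s)(c + z)`), vanishes identically.  The axis may be ANY vertical line,
and only ONE slice is used — this covers the rotational branch of LRC′ with an axis moving in time. -/
theorem eq_zero_of_curl_axisymmetric_slice (hrate : HasTypeITimeDecay C v)
    (hcont : ContinuousOn (uncurry v) (Iio (0 : ℝ) ×ˢ univ))
    (hmild : ∀ s t : ℝ, s < t → t < 0 → ∀ x,
      v t x = heatExtension (v s) (t - s) x - oseenDuhamel 1 s v v t x)
    (hdiv : ∀ t < 0, VectorCalculus.IsDivFree (v t))
    (hpol : ∀ s < 0, ∀ y, ⟪curl (v s) y, EuclideanSpace.single 2 1⟫_ℝ = 0)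
    (c : EuclideanSpace ℝ (Fin 3)) {s : ℝ} (hs : s < 0)
    (haxi : IsAxisymmetric (fun y => curl (v s) (y + c))) : ∀ t < 0, ∀ x, v t x = 0 := by
  obtain ⟨hrate₁, hcont₁, hmild₁, hdiv₁⟩ := class_translate c hrate hcont hmild hdiv
  have hcurl : ∀ t (y : EuclideanSpace ℝ (Fin 3)), curl ((fun t y => v t (y + c)) t) y = curl (v t) (y + c) :=
    fun t y => curl_comp_add_const (v t) c y
  have hpol₁ : ∀ s < 0, ∀ y, ⟪curl ((fun t y => v t (y + c)) s) y, EuclideanSpace.single 2 1⟫_ℝ = 0 :=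
    fun s hs y => by rw [hcurl]; exact hpol s hs (y + c)
  have haxi₁ : IsAxisymmetric (curl ((fun t y => v t (y + c)) s)) := by
    have e : curl ((fun t y => v t (y + c)) s) = fun y => curl (v s) (y + c) := funext (hcurl s)
    rw [e]; exact haxi
  have h := eq_zero_of_curl_axisymmetric_slice₀ hrate₁ hcont₁ hmild₁ hdiv₁ hpol₁ hs haxi₁
  intro t ht x
  have := h t ht (x - c)
  simpa using this

/-- **(A′₁), crux form**: not backward-singular at the apex. -/
theorem nonflatLiouville_of_curl_axisymmetric_slice (hrate : HasTypeITimeDecay C v)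
    (hcont : ContinuousOn (uncurry v) (Iio (0 : ℝ) ×ˢ univ))
    (hmild : ∀ s t : ℝ, s < t → t < 0 → ∀ x,
      v t x = heatExtension (v s) (t - s) x - oseenDuhamel 1 s v v t x)
    (hdiv : ∀ t < 0, VectorCalculus.IsDivFree (v t))
    (hpol : ∀ s < 0, ∀ y, ⟪curl (v s) y, EuclideanSpace.single 2 1⟫_ℝ = 0)
    (c : EuclideanSpace ℝ (Fin 3)) {s : ℝ} (hs : s < 0)
    (haxi : IsAxisymmetric (fun y => curl (v s) (y + c))) : ¬ IsBackwardSingularPoint v 0 :=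
  not_backwardSingular_of_zero (eq_zero_of_curl_axisymmetric_slice hrate hcont hmild hdiv hpol c hs haxi)

/-! ### the germ form: a rotational Killing identity for the vorticity on an open set of ONE slice -/

/-- **A ROTATIONAL KILLING GERM OF THE VORTICITY ON ONE SLICE KILLS THE PROFILE.**  Let `v` be a profile of the route's
Type-I class, poloidal along `e₃` on every slice.  If on ONE slice `s < 0` the Lie derivative of `ω = curl v(s)` along
the rotation field about the vertical axis through `c` vanishes on a nonempty open set,
`J ω(y) = Dω(y)(J(y − c))` for `y ∈ U`, then `v ≡ 0`.  (L2 of the proposed line «lrc-jet» in its strongest form: no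
space–time set and no fixed axis are needed.) -/
theorem eq_zero_of_curl_rotDefect_eq_zero_on_open (hrate : HasTypeITimeDecay C v)
    (hcont : ContinuousOn (uncurry v) (Iio (0 : ℝ) ×ˢ univ))
    (hmild : ∀ s t : ℝ, s < t → t < 0 → ∀ x,
      v t x = heatExtension (v s) (t - s) x - oseenDuhamel 1 s v v t x)
    (hdiv : ∀ t < 0, VectorCalculus.IsDivFree (v t))
    (hpol : ∀ s < 0, ∀ y, ⟪curl (v s) y, EuclideanSpace.single 2 1⟫_ℝ = 0)
    (c : EuclideanSpace ℝ (Fin 3)) {s : ℝ} (hs : s < 0) {U : Set (EuclideanSpace ℝ (Fin 3))} (hU : IsOpen U)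
    (hne : U.Nonempty)
    (h : ∀ y ∈ U, rotGen (curl (v s) y) = fderiv ℝ (curl (v s)) y (rotGen (y - c))) :
    ∀ t < 0, ∀ x, v t x = 0 := by
  have hbdd := bdd_of_hasTypeITimeDecay hrate
  have hA : AnalyticOnNhd ℝ (v s) univ := analyticOnNhd_slice hcont hbdd hmild hs
  have hω : AnalyticOnNhd ℝ (curl (v s)) univ := analyticOnNhd_curl hA
  -- the translated vorticity slice
  set V : EuclideanSpace ℝ (Fin 3) → EuclideanSpace ℝ (Fin 3) := fun y => curl (v s) (y + c) with hVdef
  have hτ : AnalyticOnNhd ℝ (fun y : EuclideanSpace ℝ (Fin 3) => y + c) univ := fun y _ =>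
    analyticAt_id.add analyticAt_const
  have hVA : AnalyticOnNhd ℝ V univ := hω.comp hτ (fun _ _ => mem_univ _)
  have hV1 : ContDiff ℝ 1 V := hVA.contDiff
  have hDVy : ∀ y, fderiv ℝ V y = fderiv ℝ (curl (v s)) (y + c) := fun y => by
    simp only [hVdef]
    exact fderiv_comp_add_right (𝕜 := ℝ) (f := curl (v s)) (x := y) c
  have hU' : IsOpen ((fun y : EuclideanSpace ℝ (Fin 3) => y + c) ⁻¹' U) :=
    hU.preimage (continuous_id.add continuous_const)
  have hne' : ((fun y : EuclideanSpace ℝ (Fin 3) => y + c) ⁻¹' U).Nonempty := by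
    obtain ⟨u, hu⟩ := hne
    exact ⟨u - c, by simpa using hu⟩
  have hgerm : ∀ y ∈ (fun y : EuclideanSpace ℝ (Fin 3) => y + c) ⁻¹' U,
      rotGen (V y) = fderiv ℝ V y (rotGen y) := by
    intro y hy
    rw [hDVy y, hVdef]
    have h1 := h (y + c) hy
    rwa [add_sub_cancel_right] at h1
  have hall := rotDefect_eq_zero_of_eqOn_open hVA hU' hne' hgerm
  have haxi : IsAxisymmetric V := isAxisymmetric_of_rotDefect_eq_zero hV1 hall
  exact eq_zero_of_curl_axisymmetric_slice hrate hcont hmild hdiv hpol c hs haxi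

/-- **The rotational Killing germ of the vorticity, crux form**: not backward-singular at the apex. -/
theorem nonflatLiouville_of_curl_rotDefect_eq_zero_on_open (hrate : HasTypeITimeDecay C v)
    (hcont : ContinuousOn (uncurry v) (Iio (0 : ℝ) ×ˢ univ))
    (hmild : ∀ s t : ℝ, s < t → t < 0 → ∀ x,
      v t x = heatExtension (v s) (t - s) x - oseenDuhamel 1 s v v t x)
    (hdiv : ∀ t < 0, VectorCalculus.IsDivFree (v t))
    (hpol : ∀ s < 0, ∀ y, ⟪curl (v s) y, EuclideanSpace.single 2 1⟫_ℝ = 0)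
    (c : EuclideanSpace ℝ (Fin 3)) {s : ℝ} (hs : s < 0) {U : Set (EuclideanSpace ℝ (Fin 3))} (hU : IsOpen U)
    (hne : U.Nonempty)
    (h : ∀ y ∈ U, rotGen (curl (v s) y) = fderiv ℝ (curl (v s)) y (rotGen (y - c))) :
    ¬ IsBackwardSingularPoint v 0 :=
  not_backwardSingular_of_zero (eq_zero_of_curl_rotDefect_eq_zero_on_open hrate hcont hmild hdiv hpol c hs hU hne h)

end Summit.NavierStokesRegularity.NavierStokesRegularity.Theorems.PoloidalWindowDoorPoloidalWindowRigidityOneSliceCurlAxisymmetric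

end
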